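import Literature.MathematicalPhysics.QuantumFieldTheory.Balaban1983to89.Beta.FreeLegDictionary
import Literature.MathematicalPhysics.QuantumFieldTheory.Balaban1983to89.Beta.PuncturedRiemannSum

/-!
# Beta / WoodburySymbol — the Woodbury (block-averaging) correction `R⊥` of the one-step fluctuation propagator is,
on EVERY torus, the punctured coarse-momentum average of ONE volume-independent `2π`-periodic symbol
`F(θ; x, x′) = κ(θ)·A(θ; x)·conj A(θ; x′)`, continuous off the resonant set `(2πℤ)^d` with an `O(1/ε(θ))` majorant;
hence `N^d R⊥_{N,(m,…,m)}(x,x′) → (2π)^{-d}∫_{[-π,π]^d} F(θ; x, x′) dθ` along the cubic tori (`d ≥ 3`)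

HONEST FRAMING (verbatim, page 1 of everything this cell writes): discharging `BetaPertH` makes Bałaban's UV
stability UNCONDITIONAL — a real constructive-QFT result; it is NOT the continuum limit and NOT the Clay problem.
This module is a volume-bookkeeping certificate for the scalar site-averaged model of `Beta/WoodburyFibre`; it proves
nothing about `BetaPertH` by itself.

WHAT IS PROVED (sorry-free; every statement is either kernel-checked here or an identity of definitions already in the
tree — no manuscript step is cited as a fact).
* §0 the CONTINUUM SYMBOLS as functions of a REAL coarse momentum `θ ∈ ℝ^d` (`n = N` the block side, alias index
  `k ∈ {0,…,n−1}^d`, `ω_ν = e^{i(θ_ν+2πk_ν)/n}` = `B5Block118.om`): `uc` (`u_k(θ)`, King's averaging weight),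
  `sig` (`σ_k(θ) = m² + Σ_ν n²(2 − 2cos((θ_ν+2πk_ν)/n))` = `B4Strip.DeltaXir ∘ shiftr`), `phc` (the phase at an
  integer point), `Ac` (`A(θ;x) = Σ_k conj(phase)·u_k/σ_k`), `Sc` (`S(θ) = Σ_k |u_k|²/σ_k`, King's (4.5)),
  `kc` (`κ = a/(1+aS)`), `Fc` (`F = κ·A(·;x)·conj A(·;x′)`).
* §1 IDENTIFICATION on an arbitrary torus `Π_μ ℤ/(nM_μ)`: `u_pOf`, `lapSym_pOf_eq_sig`, `chi_pOf_eq_phc`, `famp_eq_Ac`,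
  `Sfib_eq_Sc`, `kap_eq_kc`, `fibreTerm_eq_Fc`, and
  `Rperp_eq_sum_Fc : R⊥(x,x′) = |T_fine|⁻¹ Σ_{q ≠ 0} F(sOf q; val x, val x′)` — the Woodbury kernel of
  `WoodburyFibre.Rperp` is a punctured sum of the SAME function `F` over the coarse momenta of the torus.
* §2 `2π`-PERIODICITY (`Fc_periodic`): an integer shift `θ ↦ θ + 2πz` permutes the alias index cyclically
  (`kshift`, `shiftr_kshift`, `om_shift`), so `A`, `S`, `κ`, `F` are `2π`-periodic in every coordinate.
* §3 CONTINUITY: every alias symbol is positive on the NON-RESONANT SET `nonRes = {θ : ε(θ) > 0} = ℝ^d ∖ (2πℤ)^d`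
  (`sig_pos`; `ε` = lit1's `dispersion`), which is open and contains the punctured zone; `A`, `S`, `κ`, `F` are
  continuous there (`continuousOn_Fc`, `continuousOn_Fc_brillouin`).
* §4 MAJORANT BY DENSITY (`norm_Fc_le`): `‖F(θ; x, x′)‖ ≤ C₀ + (π²/4)/ε(θ)` on `nonRes`
  (`C₀ = 2·aliasC(d)²·(π²/4)^d·(dπ² + m²)`), obtained WITHOUT redoing King's alias estimates in the continuum: the
  torus bound `WoodburyFibre.fibre_term_le` holds at every non-resonant rational point `θ_m = 2π⌊mθ/2π⌋/m`
  (`norm_Fc_thApprox_le`, using §1–§2 on the cubic torus of period `m`, `WoodburyFibre.lapSym_z` and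
  `(8/π²)ε ≤ Δ_ξ + m²` = `dispersion_le_DeltaXir` from `King1986.DeltaXir_ge_momSq`), `θ_m → θ`
  (`tendsto_thApprox`), and both sides are continuous at `θ`.
* §5 INFINITE VOLUME: `Rperp_cubic_eq : N^d R⊥_{N,(m,…,m)}(x,x′) = m^{-d} Σ_{k ≠ 0} F(2πk/m; x, x′)` and
  `Rperp_tendsto_infiniteVolume` (`d ≥ 3`, even `m → ∞`, fixed integer points): the punctured average converges to
  `(2π)^{-d}∫_{[-π,π]^d} F` by `PuncturedRiemannSum.momentumAverage_singular_approx` (the `O(1/ε)` singularity is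
  integrable in `d ≥ 3`); `norm_integral_Fc_le` (`d = 4`): the volume-uniform flat bound `‖R⊥‖ ≤ D/N⁴` of
  `WoodburyFibre.norm_Rperp_le` passes to the limit, `‖(2π)^{-4}∫F‖ ≤ D(m²)`.
* §6 (v1.1, append-only) THE LIMIT KERNEL `RperpLim` (`R⊥_∞(x,x′) := N^{-d}(2π)^{-d}∫F`) on integer points, its
  literal differences `dRperpLim` / `dRperpLim'` / `ddRperpLim` (`bump` = `x ↦ x + e_μ`, `emb` = the embedding
  `ℕ^d → Π ℤ/(nm)`, `emb_bump`), the convergences `Rperp_tendsto_RperpLim`, `dRperp_tendsto`, `dRperp'_tendsto`,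
  `ddRperp_tendsto` of `WoodburyFibre.Rperp` / `dRperp` / `dRperp'` / `ddRperp` at embedded points along the even
  cubic tori (`d ≥ 3`), the inherited Hermitian symmetry `RperpLim_swap`, and — `d = 4` — the transfer of EVERY
  volume-uniform bound of `WoodburyFibre`: `norm_RperpLim_le` (`≤ D/N⁴`), `norm_dRperpLim_le` and
  `norm_dRperpLim'_le` (`≤ D₁/N⁵`), `norm_ddRperpLim_le` (`≤ D₂/N⁶`) (pattern `norm_le_of_near`).

ROLE. This is the `R⊥`-specific half of route (ii-a) of the cell's gap G-an5g8-2 (the `T^{(j+1)} ↗ ℤ^d` bookkeeping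
of B12 p. 264 for the one-step fluctuation propagator `Γ = P + R⊥`): the free leg `P` is handled by
`Beta/FreeLegDictionary` (`torusFreeLeg_limit`), the generic Riemann-sum analysis by `Beta/PuncturedRiemannSum`.
NOT done here: the analogous symbol identification + transfer for the OTHER finite-volume certificates of the cell
(`LargeLWindow` / `LongitudinalWindow` lattice-unit window bounds, `WoodburyCovariant`) — same pattern, their fibre
terms are again sums over `q ≠ 0` of alias expressions in `sOf q` —, convergence RATES, gauge fields, the continuum
limit.

SOURCES. C. King, Commun. Math. Phys. 102 (1986) 649–677 [King1986], (4.5) p. 670 (the alias sum `S(p′)`),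
(4.20)–(4.22) p. 672 (the alias bounds, used only through the tree theorem `WoodburyFibre.fibre_term_le`); T. Bałaban,
Commun. Math. Phys. 95 (1984) 17–40 [Balaban1984PropagatorsI] («B5»), (1.18) (block momenta `p = p′ + 2πk`, used only
through the tree's `B5Block118.pOf`);
everything else is [folklore] Fourier analysis on finite tori, proved here.
-/

open Finset Real
open scoped BigOperators ComplexConjugate

namespace Literature.MathematicalPhysics.QuantumFieldTheory.Balaban1983to89.Beta.WoodburySymbol

open Literature.MathematicalPhysics.QuantumFieldTheory.King1986.Torus (u fib z Sfib kap lapSym sum_fib_eq_sum_pOf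
  lapSym_pOf)
open Literature.MathematicalPhysics.QuantumFieldTheory.Balaban1983to89.B5Prop11Plancherel (Tor fine chi sOf abs_sOf_le)
open Literature.MathematicalPhysics.QuantumFieldTheory.Balaban1983to89.B4Strip (Sxir DeltaXir shiftr)
open Literature.MathematicalPhysics.QuantumFieldTheory.Balaban1983to89.B5Block118 (pOf om iota chi_pOf_iota
  stdAddChar_pOf_mul_natCast)
open Literature.MathematicalPhysics.QuantumFieldTheory.Balaban1983to89.Beta.WoodburyFibre (famp Rperp)
open Literature.MathematicalPhysics.QuantumFieldTheory.Balaban1983to89.Beta.FreeLegDictionary (cubic card_tor_fine_cubic)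

variable {d : ℕ} (n : ℕ) [NeZero n]

/-- The CONTINUUM ALIAS WEIGHT `u_k(θ) = n^{-d} Σ_{j ∈ {0,…,n−1}^d} Π_ν ω_ν^{j_ν}`, `ω_ν = e^{i(θ_ν + 2πk_ν)/n}`: King's
block-averaging symbol `u(p′ + 2πk)` as a function of a REAL coarse momentum `θ = p′ ∈ ℝ^d`. [folklore] -/
noncomputable def uc (k : Fin d → Fin n) (θ : Fin d → ℝ) : ℂ :=
  ((n : ℂ) ^ d)⁻¹ * ∑ j : Fin d → Fin n, ∏ ν, om n k θ ν ^ (j ν : ℕ)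

/-- The CONTINUUM FINE SYMBOL at the alias: `σ_k(θ) = m² + Σ_ν S_ξ(θ_ν + 2πk_ν)`, `S_ξ(s) = n²(2 − 2cos(s/n))`
(`= DeltaXir n m² (shiftr n k θ)`). [folklore] -/
noncomputable def sig (m2 : ℝ) (k : Fin d → Fin n) (θ : Fin d → ℝ) : ℝ := DeltaXir n m2 (shiftr n k θ)

/-- The CONTINUUM PHASE `e^{i(p′+2πk)·x/n} = Π_ν ω_ν^{x_ν}` at an integer point `x ∈ ℕ^d`. [folklore] -/
noncomputable def phc (k : Fin d → Fin n) (θ : Fin d → ℝ) (x : Fin d → ℕ) : ℂ := ∏ ν, om n k θ ν ^ (x ν)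

/-- The CONTINUUM FIBRE AMPLITUDE `A(θ; x) = Σ_k conj(e^{i(θ+2πk)·x/n}) u_k(θ)/σ_k(θ)`. [folklore] -/
noncomputable def Ac (m2 : ℝ) (x : Fin d → ℕ) (θ : Fin d → ℝ) : ℂ :=
  ∑ k : Fin d → Fin n, conj (phc n k θ x) * (uc n k θ / (sig n m2 k θ : ℂ))

/-- The CONTINUUM ALIAS SUM `S(θ) = Σ_k |u_k(θ)|²/σ_k(θ)` (King's (4.5)). [cite: King1986, (4.5) p.670] -/
noncomputable def Sc (m2 : ℝ) (θ : Fin d → ℝ) : ℝ := ∑ k : Fin d → Fin n, ‖uc n k θ‖ ^ 2 / sig n m2 k θ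

/-- The CONTINUUM SHERMAN–MORRISON COEFFICIENT `κ(θ) = a/(1 + aS(θ))`. [folklore] -/
noncomputable def kc (a m2 : ℝ) (θ : Fin d → ℝ) : ℝ := a / (1 + a * Sc n m2 θ)

/-- THE CONTINUUM WOODBURY SYMBOL `F(θ; x, x′) = κ(θ)·A(θ;x)·conj A(θ;x′)`. [folklore] -/
noncomputable def Fc (a m2 : ℝ) (x x' : Fin d → ℕ) (θ : Fin d → ℝ) : ℂ :=
  (kc n a m2 θ : ℂ) * Ac n m2 x θ * conj (Ac n m2 x' θ)

/-! ## §1 Identification: on every torus the Woodbury kernel is a punctured coarse-momentum sum of `F` -/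

section Ident

variable (M : Fin d → ℕ) [hM : ∀ μ, NeZero (M μ)]

/-- `u(p′ + 2πk) = u_k(p′)`. [folklore] -/
theorem u_pOf (k : Fin d → Fin n) (q : Tor M) : u n M (pOf n M (k, q)) = uc n k (sOf M q) := by
  unfold u uc
  congr 1
  exact Finset.sum_congr rfl fun j _ => chi_pOf_iota n M k q j

/-- `σ(p′ + 2πk) = σ_k(p′)`. [folklore] -/
theorem lapSym_pOf_eq_sig (m2 : ℝ) (k : Fin d → Fin n) (q : Tor M) :
    lapSym (fine n M) ((n : ℝ) ^ 2) m2 (pOf n M (k, q)) = sig n m2 k (sOf M q) :=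
  lapSym_pOf n M m2 k q

/-- `e^{i(p′+2πk)·x} = Π_ν ω_ν^{x_ν}` with `x_ν` the standard representative. [folklore] -/
theorem chi_pOf_eq_phc (k : Fin d → Fin n) (q : Tor M) (x : Tor (fine n M)) :
    chi (fine n M) (pOf n M (k, q)) x = phc n k (sOf M q) (fun ν => (x ν).val) := by
  unfold chi phc
  refine Finset.prod_congr rfl fun ν _ => ?_
  have hx : x ν = (((x ν).val : ℕ) : ZMod (fine n M ν)) := (ZMod.natCast_zmod_val (x ν)).symm
  conv_lhs => rw [hx]
  exact stdAddChar_pOf_mul_natCast n M k q ν (x ν).val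

/-- `A_q(x) = A(p′(q); x)`. [folklore] -/
theorem famp_eq_Ac (m2 : ℝ) (q : Tor M) (x : Tor (fine n M)) :
    famp n M m2 q x = Ac n m2 (fun ν => (x ν).val) (sOf M q) := by
  unfold famp Ac
  rw [sum_fib_eq_sum_pOf]
  refine Finset.sum_congr rfl fun k _ => ?_
  rw [chi_pOf_eq_phc, u_pOf, lapSym_pOf_eq_sig]

/-- `S(q) = S(p′(q))`. [folklore] -/
theorem Sfib_eq_Sc (m2 : ℝ) (q : Tor M) : Sfib n M ((n : ℝ) ^ 2) m2 q = Sc n m2 (sOf M q) := by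
  unfold Sfib Sc
  rw [sum_fib_eq_sum_pOf]
  refine Finset.sum_congr rfl fun k _ => ?_
  rw [u_pOf, lapSym_pOf_eq_sig]

/-- `κ(q) = κ(p′(q))`. [folklore] -/
theorem kap_eq_kc (a m2 : ℝ) (q : Tor M) : kap n M a ((n : ℝ) ^ 2) m2 q = kc n a m2 (sOf M q) := by
  unfold kap kc
  rw [Sfib_eq_Sc]

/-- THE FIBRE TERM IS THE SYMBOL: `κ(q) A_q(x) conj A_q(x′) = F(p′(q); x, x′)`. [folklore] -/
theorem fibreTerm_eq_Fc (a m2 : ℝ) (q : Tor M) (x x' : Tor (fine n M)) :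
    (kap n M a ((n : ℝ) ^ 2) m2 q : ℂ) * famp n M m2 q x * conj (famp n M m2 q x')
      = Fc n a m2 (fun ν => (x ν).val) (fun ν => (x' ν).val) (sOf M q) := by
  rw [Fc, kap_eq_kc, famp_eq_Ac, famp_eq_Ac]

/-- **`R⊥` IS A PUNCTURED COARSE-MOMENTUM SUM OF THE SYMBOL**:
`R⊥(x,x′) = |𝕋|⁻¹ Σ_{q ≠ 0} F(p′(q); x, x′)`. [folklore] -/
theorem Rperp_eq_sum_Fc (a m2 : ℝ) (x x' : Tor (fine n M)) :
    Rperp n M a m2 x x' = ((Fintype.card (Tor (fine n M)) : ℂ))⁻¹ *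
      ∑ q ∈ (univ : Finset (Tor M)).erase 0, Fc n a m2 (fun ν => (x ν).val) (fun ν => (x' ν).val) (sOf M q) := by
  unfold Rperp
  congr 1
  exact Finset.sum_congr rfl fun q _ => fibreTerm_eq_Fc n M a m2 q x x'

end Ident


/-! ## §2 `2π`-periodicity: an integer shift of `θ` permutes the alias index `k` cyclically -/

/-- the cyclic shift `k ↦ (k + z) mod n` of the alias index. [folklore] -/
def kshift (z : Fin d → ℤ) (k : Fin d → Fin n) : Fin d → Fin n := fun ν =>
  ⟨((((k ν : ℕ) : ℤ) + z ν) % (n : ℤ)).toNat, by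
    have hn : (0 : ℤ) < n := by exact_mod_cast Nat.pos_of_ne_zero (NeZero.ne n)
    have h0 := Int.emod_nonneg (((k ν : ℕ) : ℤ) + z ν) hn.ne'
    have h1 := Int.emod_lt_of_pos (((k ν : ℕ) : ℤ) + z ν) hn
    omega⟩

/-- value of the shifted index. [folklore] -/
theorem kshift_val (z : Fin d → ℤ) (k : Fin d → Fin n) (ν : Fin d) :
    ((kshift n z k ν : ℕ) : ℤ) = (((k ν : ℕ) : ℤ) + z ν) % (n : ℤ) := by
  have hn : (0 : ℤ) < n := by exact_mod_cast Nat.pos_of_ne_zero (NeZero.ne n)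
  simp only [kshift]
  rw [Int.toNat_of_nonneg (Int.emod_nonneg _ hn.ne')]

/-- the cyclic shift is injective (hence a permutation of the finite alias index set). [folklore] -/
theorem kshift_injective (z : Fin d → ℤ) : Function.Injective (kshift n z) := by
  have hn : (0 : ℤ) < n := by exact_mod_cast Nat.pos_of_ne_zero (NeZero.ne n)
  intro k k' h
  funext ν
  have hν : ((kshift n z k ν : ℕ) : ℤ) = ((kshift n z k' ν : ℕ) : ℤ) := by rw [h]
  rw [kshift_val, kshift_val] at hν
  have hmod : Int.ModEq (n : ℤ) ((k ν : ℕ) : ℤ) ((k' ν : ℕ) : ℤ) := by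
    have h' : Int.ModEq (n : ℤ) (((k ν : ℕ) : ℤ) + z ν) (((k' ν : ℕ) : ℤ) + z ν) := hν
    simpa using h'.sub_right (z ν)
  have h1 : ((k ν : ℕ) : ℤ) % n = ((k ν : ℕ) : ℤ) :=
    Int.emod_eq_of_lt (by positivity) (by exact_mod_cast (k ν).isLt)
  have h2 : ((k' ν : ℕ) : ℤ) % n = ((k' ν : ℕ) : ℤ) :=
    Int.emod_eq_of_lt (by positivity) (by exact_mod_cast (k' ν).isLt)
  have h3 : ((k ν : ℕ) : ℤ) = ((k' ν : ℕ) : ℤ) := by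
    have := hmod
    unfold Int.ModEq at this
    rwa [h1, h2] at this
  exact Fin.ext (by exact_mod_cast h3)

/-- the fine angle of alias `k` at `θ + 2πz` is that of alias `(k+z) mod n` at `θ`, up to a multiple of `2π`. [folklore] -/
theorem shiftr_kshift (z : Fin d → ℤ) (k : Fin d → Fin n) (θ : Fin d → ℝ) (ν : Fin d) : ∃ t : ℤ,
    shiftr n k (fun μ => θ μ + 2 * π * (z μ : ℝ)) ν / n = shiftr n (kshift n z k) θ ν / n + t * (2 * π) := by
  have hn : (n : ℝ) ≠ 0 := by exact_mod_cast NeZero.ne n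
  set a : ℤ := ((k ν : ℕ) : ℤ) + z ν with ha_def
  refine ⟨a / n, ?_⟩
  have hk : ((kshift n z k ν : ℕ) : ℝ) = ((a % n : ℤ) : ℝ) := by exact_mod_cast kshift_val n z k ν
  have hdiv : ((a % n : ℤ) : ℝ) = (a : ℝ) - (n : ℝ) * ((a / n : ℤ) : ℝ) := by
    rw [Int.emod_def a n]
    push_cast
    ring
  have ha : (a : ℝ) = ((k ν : ℕ) : ℝ) + (z ν : ℝ) := by
    rw [ha_def]
    push_cast
    ring
  simp only [shiftr]
  rw [hk, hdiv, ha]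
  field_simp
  ring

/-- `ω_ν` is invariant: `ω_ν(k, θ + 2πz) = ω_ν((k+z) mod n, θ)`. [folklore] -/
theorem om_shift (z : Fin d → ℤ) (k : Fin d → Fin n) (θ : Fin d → ℝ) (ν : Fin d) :
    om n k (fun μ => θ μ + 2 * π * (z μ : ℝ)) ν = om n (kshift n z k) θ ν := by
  obtain ⟨t, ht⟩ := shiftr_kshift n z k θ ν
  unfold om
  rw [ht, Complex.ofReal_add, add_mul, Complex.exp_add]
  have h1 : Complex.exp (((t * (2 * π) : ℝ) : ℂ) * Complex.I) = 1 := by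
    have := Complex.exp_int_mul_two_pi_mul_I t
    rw [← this]
    congr 1
    push_cast
    ring
  rw [h1, mul_one]

/-- `σ` is invariant. [folklore] -/
theorem sig_shift (m2 : ℝ) (z : Fin d → ℤ) (k : Fin d → Fin n) (θ : Fin d → ℝ) :
    sig n m2 k (fun μ => θ μ + 2 * π * (z μ : ℝ)) = sig n m2 (kshift n z k) θ := by
  unfold sig DeltaXir
  congr 1
  refine Finset.sum_congr rfl fun ν _ => ?_
  obtain ⟨t, ht⟩ := shiftr_kshift n z k θ ν
  simp only [Sxir]
  rw [ht, Real.cos_add_int_mul_two_pi]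

/-- `u` is invariant. [folklore] -/
theorem uc_shift (z : Fin d → ℤ) (k : Fin d → Fin n) (θ : Fin d → ℝ) :
    uc n k (fun μ => θ μ + 2 * π * (z μ : ℝ)) = uc n (kshift n z k) θ := by
  unfold uc
  simp_rw [om_shift]

/-- the phase is invariant. [folklore] -/
theorem phc_shift (z : Fin d → ℤ) (k : Fin d → Fin n) (θ : Fin d → ℝ) (x : Fin d → ℕ) :
    phc n k (fun μ => θ μ + 2 * π * (z μ : ℝ)) x = phc n (kshift n z k) θ x := by
  unfold phc
  simp_rw [om_shift]

/-- **`A(θ; x)` is `2π`-periodic in every coordinate of `θ`** (integer `x`). [folklore] -/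
theorem Ac_periodic (m2 : ℝ) (x : Fin d → ℕ) (θ : Fin d → ℝ) (z : Fin d → ℤ) :
    Ac n m2 x (fun μ => θ μ + 2 * π * (z μ : ℝ)) = Ac n m2 x θ := by
  unfold Ac
  simp_rw [phc_shift, uc_shift, sig_shift]
  exact Fintype.sum_bijective (kshift n z) ((Finite.injective_iff_bijective).mp (kshift_injective n z)) _ _
    fun k => rfl

/-- `S(θ)` is `2π`-periodic. [folklore] -/
theorem Sc_periodic (m2 : ℝ) (θ : Fin d → ℝ) (z : Fin d → ℤ) :
    Sc n m2 (fun μ => θ μ + 2 * π * (z μ : ℝ)) = Sc n m2 θ := by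
  unfold Sc
  simp_rw [uc_shift, sig_shift]
  exact Fintype.sum_bijective (kshift n z) ((Finite.injective_iff_bijective).mp (kshift_injective n z)) _ _
    fun k => rfl

/-- `κ(θ)` is `2π`-periodic. [folklore] -/
theorem kc_periodic (a m2 : ℝ) (θ : Fin d → ℝ) (z : Fin d → ℤ) :
    kc n a m2 (fun μ => θ μ + 2 * π * (z μ : ℝ)) = kc n a m2 θ := by
  unfold kc
  rw [Sc_periodic]

/-- **THE SYMBOL `F(θ; x, x′)` IS `2π`-PERIODIC** in every coordinate of `θ`. [folklore] -/
theorem Fc_periodic (a m2 : ℝ) (x x' : Fin d → ℕ) (θ : Fin d → ℝ) (z : Fin d → ℤ) :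
    Fc n a m2 x x' (fun μ => θ μ + 2 * π * (z μ : ℝ)) = Fc n a m2 x x' θ := by
  unfold Fc
  rw [kc_periodic, Ac_periodic, Ac_periodic]

/-! ## §3 Positivity of the alias symbols off the resonant set `(2πℤ)^d` and continuity of `F` there -/

omit [NeZero n] in
/-- `S_ξ ≥ 0`. [folklore] -/
theorem Sxir_nonneg' (x : ℝ) : 0 ≤ Sxir n x := by
  unfold Sxir
  exact mul_nonneg (sq_nonneg _) (by linarith [Real.cos_le_one (x / n)])

open Literature.Probability.LatticeModels (brillouin dispersion TorusSite latticeMomentum dispersion_pos_of_mem_brillouin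
  continuous_dispersion dispersion_add_int_mul)

/-- Wherever lit1's dispersion `ε(θ) = Σ_ν(1 − cos θ_ν)` is positive (i.e. `θ ∉ (2πℤ)^d`), EVERY alias symbol is positive:
`σ_k(θ) > 0` (`m² ≥ 0`) — if `cos((θ_ν + 2πk_ν)/n) = 1` then `θ_ν ∈ 2πℤ`. [folklore] -/
theorem sig_pos {m2 : ℝ} (hm2 : 0 ≤ m2) (k : Fin d → Fin n) {θ : Fin d → ℝ} (hθ : 0 < dispersion θ) :
    0 < sig n m2 k θ := by
  have hn : (n : ℝ) ≠ 0 := by exact_mod_cast NeZero.ne n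
  -- a coordinate with `cos θ_ν < 1`
  obtain ⟨ν, hν⟩ : ∃ ν, Real.cos (θ ν) < 1 := by
    by_contra h
    push Not at h
    have : dispersion θ ≤ 0 := by
      unfold dispersion
      exact Finset.sum_nonpos fun μ _ => by linarith [h μ]
    linarith
  set x : ℝ := shiftr n k θ ν / n with hx
  have hcos : Real.cos x < 1 := by
    rcases (Real.cos_le_one x).lt_or_eq with h | h
    · exact h
    · exfalso
      obtain ⟨t, ht⟩ := (Real.cos_eq_one_iff x).1 h
      have hθν : θ ν = ((t * n - ((k ν : ℕ) : ℤ) : ℤ) : ℝ) * (2 * π) := by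
        have h1 : (t : ℝ) * (2 * π) * n = shiftr n k θ ν := by
          rw [ht, hx]; field_simp
        simp only [shiftr] at h1
        push_cast
        linarith
      have : Real.cos (θ ν) = 1 := by
        rw [hθν, Real.cos_int_mul_two_pi]
      linarith
  unfold sig DeltaXir
  have hterm : 0 < Sxir n (shiftr n k θ ν) := by
    unfold Sxir
    rw [← hx]
    have : 0 < 2 - 2 * Real.cos x := by linarith
    positivity
  have hsum : Sxir n (shiftr n k θ ν) ≤ ∑ μ, Sxir n (shiftr n k θ μ) :=
    Finset.single_le_sum (fun μ _ => Sxir_nonneg' n (shiftr n k θ μ)) (mem_univ ν)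
  linarith

variable (d) in
/-- the NON-RESONANT SET `{θ : ε(θ) > 0} = ℝ^d ∖ (2πℤ)^d` — open, contains the punctured zone. [folklore] -/
def nonRes : Set (Fin d → ℝ) := {θ | 0 < dispersion θ}

omit [NeZero n] in
variable (d) in
/-- `nonRes` is open. [folklore] -/
theorem isOpen_nonRes : IsOpen (nonRes d) := isOpen_lt continuous_const (continuous_dispersion d)

omit [NeZero n] in
/-- the punctured zone is non-resonant. [folklore] -/
theorem brillouin_diff_subset_nonRes : brillouin d \ {0} ⊆ nonRes d :=
  fun _ hθ => dispersion_pos_of_mem_brillouin hθ.1 (fun h => hθ.2 h)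

omit [NeZero n] in
/-- continuity of `ω_ν(k, ·)`. [folklore] -/
theorem continuous_om (k : Fin d → Fin n) (ν : Fin d) : Continuous fun θ : Fin d → ℝ => om n k θ ν := by
  unfold om shiftr
  refine Complex.continuous_exp.comp ?_
  refine Continuous.mul ?_ continuous_const
  exact Complex.continuous_ofReal.comp ((((continuous_apply ν).add continuous_const)).div_const _)

omit [NeZero n] in
/-- continuity of `u_k`. [folklore] -/
theorem continuous_uc (k : Fin d → Fin n) : Continuous fun θ : Fin d → ℝ => uc n k θ := by
  unfold uc
  refine continuous_const.mul (continuous_finsetSum _ fun j _ => ?_)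
  exact continuous_finsetProd _ fun ν _ => (continuous_om n k ν).pow _

omit [NeZero n] in
/-- continuity of the phase. [folklore] -/
theorem continuous_phc (k : Fin d → Fin n) (x : Fin d → ℕ) : Continuous fun θ : Fin d → ℝ => phc n k θ x := by
  unfold phc
  exact continuous_finsetProd _ fun ν _ => (continuous_om n k ν).pow _

omit [NeZero n] in
/-- continuity of `σ_k`. [folklore] -/
theorem continuous_sig (m2 : ℝ) (k : Fin d → Fin n) : Continuous fun θ : Fin d → ℝ => sig n m2 k θ := by
  unfold sig DeltaXir shiftr Sxir
  fun_prop

/-- `S(θ) ≥ 0` on the non-resonant set. [folklore] -/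
theorem Sc_nonneg {m2 : ℝ} (hm2 : 0 ≤ m2) {θ : Fin d → ℝ} (hθ : 0 < dispersion θ) : 0 ≤ Sc n m2 θ :=
  Finset.sum_nonneg fun k _ => div_nonneg (sq_nonneg _) (sig_pos n hm2 k hθ).le

/-- **`A(·; x)` is continuous on the non-resonant set.** [folklore] -/
theorem continuousOn_Ac {m2 : ℝ} (hm2 : 0 ≤ m2) (x : Fin d → ℕ) :
    ContinuousOn (fun θ => Ac n m2 x θ) (nonRes d) := by
  unfold Ac
  refine continuousOn_finsetSum _ fun k _ => ?_
  refine ContinuousOn.mul (Complex.continuous_conj.comp_continuousOn (continuous_phc n k x).continuousOn) ?_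
  refine ContinuousOn.div (continuous_uc n k).continuousOn
    (Complex.continuous_ofReal.comp_continuousOn (continuous_sig n m2 k).continuousOn) fun θ hθ => ?_
  exact_mod_cast (sig_pos n hm2 k hθ).ne'

/-- `S` is continuous on the non-resonant set. [folklore] -/
theorem continuousOn_Sc {m2 : ℝ} (hm2 : 0 ≤ m2) : ContinuousOn (fun θ => Sc n m2 θ) (nonRes d) := by
  unfold Sc
  refine continuousOn_finsetSum _ fun k _ => ?_
  exact ContinuousOn.div (((continuous_uc n k).norm).pow 2).continuousOn (continuous_sig n m2 k).continuousOn
    fun θ hθ => (sig_pos n hm2 k hθ).ne'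

/-- `κ` is continuous on the non-resonant set (`a > 0`). [folklore] -/
theorem continuousOn_kc {a m2 : ℝ} (ha : 0 < a) (hm2 : 0 ≤ m2) :
    ContinuousOn (fun θ => kc n a m2 θ) (nonRes d) := by
  unfold kc
  refine ContinuousOn.div continuousOn_const (continuousOn_const.add (continuousOn_const.mul (continuousOn_Sc n hm2)))
    fun θ hθ => ?_
  have := Sc_nonneg n hm2 (θ := θ) hθ
  positivity

/-- **THE SYMBOL `F(·; x, x′)` IS CONTINUOUS ON THE NON-RESONANT SET**, hence on the punctured zone
`[-π,π]^d ∖ {0}` (`a > 0`, `m² ≥ 0`; at `θ ∈ (2πℤ)^d` it has an `O(1/ε(θ))` singularity when `m² = 0`). [folklore] -/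
theorem continuousOn_Fc {a m2 : ℝ} (ha : 0 < a) (hm2 : 0 ≤ m2) (x x' : Fin d → ℕ) :
    ContinuousOn (Fc n a m2 x x') (nonRes d) := by
  unfold Fc
  refine ContinuousOn.mul (ContinuousOn.mul ?_ (continuousOn_Ac n hm2 x)) ?_
  · exact Complex.continuous_ofReal.comp_continuousOn (continuousOn_kc n ha hm2)
  · exact Complex.continuous_conj.comp_continuousOn (continuousOn_Ac n hm2 x')

/-- … in particular on the punctured zone. [folklore] -/
theorem continuousOn_Fc_brillouin {a m2 : ℝ} (ha : 0 < a) (hm2 : 0 ≤ m2) (x x' : Fin d → ℕ) :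
    ContinuousOn (Fc n a m2 x x') (brillouin d \ {0}) :=
  (continuousOn_Fc n ha hm2 x x').mono (brillouin_diff_subset_nonRes (d := d))

/-! ## §4 The majorant `‖F(θ)‖ ≤ C₀ + (π²/4)/ε(θ)` on the non-resonant set — by DENSITY from the torus bound

`WoodburyFibre.fibre_term_le` bounds the fibre term on EVERY torus; the coarse momenta `2πv/m` of the cubic tori are
dense, and both sides are continuous off the resonant set — no continuum redo of King's alias estimates is needed. -/

open Literature.MathematicalPhysics.QuantumFieldTheory.King1986 (momSq DeltaXir_ge_momSq)
open Literature.MathematicalPhysics.QuantumFieldTheory.Balaban1983to89.Beta.WoodburyFibre (aliasC aliasC_nonneg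
  fibre_term_le lapSym_z)
open Filter Topology

/-- the `θ`-free part of the fibre bound of `WoodburyFibre.fibre_term_le`. [folklore] -/
noncomputable def C0 (d : ℕ) (m2 : ℝ) : ℝ := 2 * aliasC d ^ 2 * ((π ^ 2 / 4) ^ d * (d * π ^ 2 + m2))

omit [NeZero n] in
/-- `C₀ ≥ 0` for `m² ≥ 0`. [folklore] -/
theorem C0_nonneg {m2 : ℝ} (hm2 : 0 ≤ m2) : 0 ≤ C0 d m2 := by
  unfold C0
  have := aliasC_nonneg d
  positivity

omit [NeZero n] in
/-- lit1's dispersion is dominated by King's central symbol: `(8/π²) ε(θ) ≤ Δ_ξ(θ) + m²` for `|θ_ν| ≤ π`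
(`1 − cos x ≤ x²/2` and `DeltaXir_ge_momSq`). [folklore] -/
theorem dispersion_le_DeltaXir (hn : 1 ≤ n) {m2 : ℝ} (hm2 : 0 ≤ m2) {θ : Fin d → ℝ} (hθ : ∀ ν, |θ ν| ≤ π) :
    8 / π ^ 2 * dispersion θ ≤ DeltaXir n m2 θ := by
  have h1 := DeltaXir_ge_momSq hn hm2 hθ
  have h2 : dispersion θ ≤ momSq θ / 2 := by
    unfold dispersion momSq
    rw [Finset.sum_div]
    refine Finset.sum_le_sum fun ν _ => ?_
    have := Real.one_sub_sq_div_two_le_cos (x := θ ν)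
    linarith
  have h3 : 8 / π ^ 2 * dispersion θ ≤ 8 / π ^ 2 * (momSq θ / 2) := mul_le_mul_of_nonneg_left h2 (by positivity)
  have h4 : 8 / π ^ 2 * (momSq θ / 2) = 4 / π ^ 2 * momSq θ := by ring
  linarith

/-- the RATIONAL APPROXIMANTS `v_m(θ) = ⌊mθ/2π⌋ ∈ ℤ^d`. [folklore] -/
noncomputable def vApprox (m : ℕ) (θ : Fin d → ℝ) : Fin d → ℤ := fun ν => ⌊(m : ℝ) * θ ν / (2 * π)⌋

/-- `θ_m = 2π v_m(θ)/m → θ`. [folklore] -/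
noncomputable def thApprox (m : ℕ) (θ : Fin d → ℝ) : Fin d → ℝ := fun ν => 2 * π * (vApprox m θ ν : ℝ) / m

omit [NeZero n] in
/-- `θ_ν − 2π/m < θ_m,ν ≤ θ_ν`. [folklore] -/
theorem thApprox_bounds {m : ℕ} (hm : 0 < m) (θ : Fin d → ℝ) (ν : Fin d) :
    θ ν - 2 * π / m < thApprox m θ ν ∧ thApprox m θ ν ≤ θ ν := by
  have hmR : (0 : ℝ) < m := by exact_mod_cast hm
  set y : ℝ := (m : ℝ) * θ ν / (2 * π) with hy
  have hθ : θ ν = 2 * π * y / m := by rw [hy]; field_simp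
  have hlo : θ ν - 2 * π / m = 2 * π * (y - 1) / m := by rw [hθ]; field_simp
  simp only [thApprox, vApprox, ← hy]
  constructor
  · rw [hlo]
    gcongr
    exact Int.sub_one_lt_floor y
  · rw [hθ]
    gcongr
    exact Int.floor_le y

omit [NeZero n] in
/-- `θ_m → θ`. [folklore] -/
theorem tendsto_thApprox (θ : Fin d → ℝ) : Tendsto (fun m : ℕ => thApprox m θ) atTop (𝓝 θ) := by
  rw [tendsto_pi_nhds]
  intro ν
  have hlo : Tendsto (fun m : ℕ => θ ν - 2 * π / (m : ℝ)) atTop (𝓝 (θ ν)) := by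
    have := (tendsto_const_div_atTop_nhds_zero_nat (2 * π)).const_sub (θ ν)
    simpa using this
  refine tendsto_of_tendsto_of_tendsto_of_le_of_le' hlo tendsto_const_nhds ?_ ?_
  · filter_upwards [eventually_gt_atTop 0] with m hm using (thApprox_bounds hm θ ν).1.le
  · filter_upwards [eventually_gt_atTop 0] with m hm using (thApprox_bounds hm θ ν).2

omit [NeZero n] in
/-- the coarse momentum of the class of `v_m(θ)` on the cubic torus of period `m` is `θ_m` modulo `2π`. [folklore] -/
theorem sOf_vApprox (m : ℕ) [NeZero m] (θ : Fin d → ℝ) : ∃ w : Fin d → ℤ,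
    sOf (cubic d m) (fun ν => ((vApprox m θ ν : ℤ) : ZMod m)) = fun ν => thApprox m θ ν + 2 * π * (w ν : ℝ) := by
  have hmR : (m : ℝ) ≠ 0 := by exact_mod_cast NeZero.ne m
  have key : ∀ ν, ∃ t : ℤ,
      sOf (cubic d m) (fun ν => ((vApprox m θ ν : ℤ) : ZMod m)) ν = thApprox m θ ν + 2 * π * (t : ℝ) := by
    intro ν
    have hc : (((((vApprox m θ ν : ℤ) : ZMod m)).valMinAbs : ℤ) : ZMod m) = ((vApprox m θ ν : ℤ) : ZMod m) :=
      ZMod.coe_valMinAbs _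
    rw [ZMod.intCast_eq_intCast_iff_dvd_sub] at hc
    obtain ⟨t, ht⟩ := hc
    refine ⟨-t, ?_⟩
    have hval : (((((vApprox m θ ν : ℤ) : ZMod m)).valMinAbs : ℤ) : ℝ) = (vApprox m θ ν : ℝ) - (m : ℝ) * (t : ℝ) := by
      have h := congrArg (fun z : ℤ => (z : ℝ)) ht
      push_cast at h
      linarith
    simp only [sOf, thApprox, cubic]
    rw [hval]
    push_cast
    field_simp
    ring
  choose w hw using key
  exact ⟨w, funext hw⟩

/-- a NON-RESONANT approximant has a nonzero class (else every `θ_m,ν ∈ 2πℤ`). [folklore] -/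
theorem vApprox_class_ne_zero (m : ℕ) [NeZero m] {θ : Fin d → ℝ} (hres : thApprox m θ ∈ nonRes d) :
    (fun ν => ((vApprox m θ ν : ℤ) : ZMod m)) ≠ (0 : Tor (cubic d m)) := by
  intro h
  have hmR : (m : ℝ) ≠ 0 := by exact_mod_cast NeZero.ne m
  have hcos : ∀ ν, Real.cos (thApprox m θ ν) = 1 := by
    intro ν
    have hν := congr_fun h ν
    simp only [Pi.zero_apply] at hν
    rw [ZMod.intCast_zmod_eq_zero_iff_dvd] at hν
    obtain ⟨t, ht⟩ := hν
    have : thApprox m θ ν = (t : ℝ) * (2 * π) := by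
      simp only [thApprox]
      rw [ht]
      push_cast
      field_simp
    rw [this, Real.cos_int_mul_two_pi]
  have h0 : dispersion (thApprox m θ) = 0 := by
    unfold dispersion
    exact Finset.sum_eq_zero fun ν _ => by rw [hcos ν]; ring
  have := hres
  simp only [nonRes, Set.mem_setOf_eq, h0, lt_self_iff_false] at this

omit [NeZero n] in
/-- standard representatives below the period. [folklore] -/
theorem val_natCast_fine {m : ℕ} [NeZero m] {x : Fin d → ℕ} (hx : ∀ ν, x ν < n * m) :
    (fun ν => ((((x ν : ℕ) : ZMod (fine n (cubic d m) ν))).val)) = x :=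
  funext fun ν => ZMod.val_cast_of_lt (hx ν)

/-- THE TORUS BOUND AT THE APPROXIMANT: `‖F(θ_m; x, x′)‖ ≤ C₀ + (π²/4)/ε(θ_m)` whenever `θ_m` is non-resonant and the
torus of period `n·m` holds `x, x′` — `fibre_term_le` on the cubic torus of period `m`, the identification of §1, the
periodicity of §2, and `σ(z q) = Δ_ξ(p′) + m² ≥ (8/π²) ε(p′)`. [folklore] -/
theorem norm_Fc_thApprox_le (hd : 0 < d) (hn : 1 ≤ n) {a m2 : ℝ} (ha : 0 < a) (hm2 : 0 ≤ m2) (x x' : Fin d → ℕ)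
    {θ : Fin d → ℝ} {m : ℕ} [NeZero m] (hx : ∀ ν, x ν < n * m) (hx' : ∀ ν, x' ν < n * m)
    (hres : thApprox m θ ∈ nonRes d) :
    ‖Fc n a m2 x x' (thApprox m θ)‖ ≤ C0 d m2 + (π ^ 2 / 4) / dispersion (thApprox m θ) := by
  obtain ⟨w, hw⟩ := sOf_vApprox (d := d) m θ
  have hq := vApprox_class_ne_zero (d := d) m hres
  set q : Tor (cubic d m) := fun ν => ((vApprox m θ ν : ℤ) : ZMod m) with hq_def
  set xm : Tor (fine n (cubic d m)) := fun ν => ((x ν : ℕ) : ZMod (fine n (cubic d m) ν)) with hxm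
  set xm' : Tor (fine n (cubic d m)) := fun ν => ((x' ν : ℕ) : ZMod (fine n (cubic d m) ν)) with hxm'
  have hvx : (fun ν => (xm ν).val) = x := val_natCast_fine n hx
  have hvx' : (fun ν => (xm' ν).val) = x' := val_natCast_fine n hx'
  -- identification with the fibre term on the torus of periods `n·m`
  have hid : (kap n (cubic d m) a ((n : ℝ) ^ 2) m2 q : ℂ) * famp n (cubic d m) m2 q xm * conj (famp n (cubic d m) m2 q xm')
      = Fc n a m2 x x' (thApprox m θ) := by
    rw [fibreTerm_eq_Fc, hvx, hvx', hw, Fc_periodic]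
  have hB := fibre_term_le n (cubic d m) hd hn ha hm2 hq xm xm'
  rw [hid, lapSym_z] at hB
  -- the central symbol dominates the dispersion
  have hεeq : dispersion (sOf (cubic d m) q) = dispersion (thApprox m θ) := by
    rw [hw, dispersion_add_int_mul]
  have hεpos : 0 < dispersion (thApprox m θ) := hres
  have hD := dispersion_le_DeltaXir n hn hm2 (fun ν => abs_sOf_le (cubic d m) q ν)
  rw [hεeq] at hD
  have hDpos : 0 < DeltaXir n m2 (sOf (cubic d m) q) := lt_of_lt_of_le (by positivity) hD
  have h2 : 2 / DeltaXir n m2 (sOf (cubic d m) q) ≤ (π ^ 2 / 4) / dispersion (thApprox m θ) := by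
    rw [div_le_div_iff₀ hDpos hεpos]
    have := mul_le_mul_of_nonneg_left hD (by positivity : (0 : ℝ) ≤ π ^ 2 / 4)
    calc 2 * dispersion (thApprox m θ) = π ^ 2 / 4 * (8 / π ^ 2 * dispersion (thApprox m θ)) := by
          field_simp
          ring
      _ ≤ π ^ 2 / 4 * DeltaXir n m2 (sOf (cubic d m) q) := this
  calc ‖Fc n a m2 x x' (thApprox m θ)‖
      ≤ 2 / DeltaXir n m2 (sOf (cubic d m) q) + 2 * aliasC d ^ 2 * ((π ^ 2 / 4) ^ d * (d * π ^ 2 + m2)) := hB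
    _ ≤ (π ^ 2 / 4) / dispersion (thApprox m θ) + C0 d m2 := add_le_add h2 le_rfl
    _ = C0 d m2 + (π ^ 2 / 4) / dispersion (thApprox m θ) := add_comm _ _

/-- **THE MAJORANT ON THE NON-RESONANT SET**: `‖F(θ; x, x′)‖ ≤ C₀ + (π²/4)/ε(θ)` for every `θ ∉ (2πℤ)^d`
(`d ≥ 1`, `n ≥ 1`, `a > 0`, `m² ≥ 0`) — by DENSITY: `θ_m → θ`, the torus bound holds at every non-resonant `θ_m`
(eventually all of them), and both sides are continuous at `θ`. [folklore] -/
theorem norm_Fc_le (hd : 0 < d) (hn : 1 ≤ n) {a m2 : ℝ} (ha : 0 < a) (hm2 : 0 ≤ m2) (x x' : Fin d → ℕ)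
    {θ : Fin d → ℝ} (hθ : θ ∈ nonRes d) :
    ‖Fc n a m2 x x' θ‖ ≤ C0 d m2 + (π ^ 2 / 4) / dispersion θ := by
  have hT := tendsto_thApprox (d := d) θ
  have hcont : ContinuousAt (Fc n a m2 x x') θ :=
    (continuousOn_Fc n ha hm2 x x').continuousAt ((isOpen_nonRes d).mem_nhds hθ)
  have hg : Tendsto (fun m : ℕ => ‖Fc n a m2 x x' (thApprox m θ)‖) atTop (𝓝 ‖Fc n a m2 x x' θ‖) :=
    (hcont.tendsto.comp hT).norm
  have hεc : ContinuousAt (dispersion (d := d)) θ := (continuous_dispersion d).continuousAt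
  have hθ0 : dispersion θ ≠ 0 := ne_of_gt hθ
  have hh : Tendsto (fun m : ℕ => C0 d m2 + (π ^ 2 / 4) / dispersion (thApprox m θ)) atTop
      (𝓝 (C0 d m2 + (π ^ 2 / 4) / dispersion θ)) :=
    tendsto_const_nhds.add (tendsto_const_nhds.div (hεc.tendsto.comp hT) hθ0)
  have hres : ∀ᶠ m : ℕ in atTop, thApprox m θ ∈ nonRes d := hT.eventually ((isOpen_nonRes d).mem_nhds hθ)
  set m₀ : ℕ := univ.sup x + univ.sup x' + 1 with hm₀
  have hev : ∀ᶠ m : ℕ in atTop,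
      ‖Fc n a m2 x x' (thApprox m θ)‖ ≤ C0 d m2 + (π ^ 2 / 4) / dispersion (thApprox m θ) := by
    filter_upwards [hres, eventually_ge_atTop m₀] with m hm hmm₀
    haveI : NeZero m := ⟨by omega⟩
    have hnm : m ≤ n * m := Nat.le_mul_of_pos_left m (by omega)
    have hx : ∀ ν, x ν < n * m := fun ν => by
      have h1 : x ν ≤ univ.sup x := Finset.le_sup (mem_univ ν)
      omega
    have hx' : ∀ ν, x' ν < n * m := fun ν => by
      have h1 : x' ν ≤ univ.sup x' := Finset.le_sup (mem_univ ν)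
      omega
    exact norm_Fc_thApprox_le n hd hn ha hm2 x x' hx hx' hm
  exact le_of_tendsto_of_tendsto hg hh hev

/-- … in particular on the punctured zone (the hypothesis shape of `PuncturedRiemannSum`). [folklore] -/
theorem norm_Fc_le_of_mem_brillouin (hd : 0 < d) (hn : 1 ≤ n) {a m2 : ℝ} (ha : 0 < a) (hm2 : 0 ≤ m2)
    (x x' : Fin d → ℕ) (θ : Fin d → ℝ) (hθ : θ ∈ brillouin d) (hθ0 : θ ≠ 0) :
    ‖Fc n a m2 x x' θ‖ ≤ C0 d m2 + (π ^ 2 / 4) / dispersion θ :=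
  norm_Fc_le n hd hn ha hm2 x x' (brillouin_diff_subset_nonRes (d := d) ⟨hθ, hθ0⟩)

/-! ## §5 The infinite-volume limit of the Woodbury kernel along the cubic tori `T ↗ ℤ^d` -/

open Literature.MathematicalPhysics.QuantumFieldTheory.Balaban1983to89.Beta.PuncturedRiemannSum
  (momentumAverage_singular_approx)

omit [NeZero n] in
/-- on a cubic torus King's centred coarse momentum and lit1's `latticeMomentum` agree modulo `2π`. [folklore] -/
theorem sOf_cubic_congr (m : ℕ) [NeZero m] (q : Tor (cubic d m)) : ∃ w : Fin d → ℤ,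
    sOf (cubic d m) q = fun ν => latticeMomentum m q ν + 2 * π * (w ν : ℝ) := by
  have hmR : (m : ℝ) ≠ 0 := by exact_mod_cast NeZero.ne m
  have key : ∀ ν, ∃ t : ℤ, sOf (cubic d m) q ν = latticeMomentum m q ν + 2 * π * (t : ℝ) := by
    intro ν
    have hc : ((((q ν).valMinAbs : ℤ)) : ZMod m) = (((q ν).val : ℤ) : ZMod m) := by
      rw [ZMod.coe_valMinAbs, Int.cast_natCast, ZMod.natCast_zmod_val]
    rw [ZMod.intCast_eq_intCast_iff_dvd_sub] at hc
    obtain ⟨t, ht⟩ := hc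
    refine ⟨-t, ?_⟩
    have hval : (((q ν).valMinAbs : ℤ) : ℝ) = ((q ν).val : ℝ) - (m : ℝ) * (t : ℝ) := by
      have h := congrArg (fun z : ℤ => (z : ℝ)) ht
      push_cast at h
      linarith
    simp only [sOf, latticeMomentum, cubic]
    rw [hval]
    push_cast
    field_simp
    ring
  choose w hw using key
  exact ⟨w, funext hw⟩

/-- **ON A CUBIC TORUS `N^d R⊥` IS A PUNCTURED MOMENTUM AVERAGE OF THE SYMBOL**:
`N^d R⊥(x,x′) = m^{-d} Σ_{k ≠ 0} F(2πk/m; x, x′)`. [folklore] -/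
theorem Rperp_cubic_eq (m : ℕ) [NeZero m] (a m2 : ℝ) (x x' : Tor (fine n (cubic d m))) :
    ((n : ℂ) ^ d) * Rperp n (cubic d m) a m2 x x' =
      (((m ^ d : ℕ) : ℝ)⁻¹) • ∑ k ∈ (univ : Finset (TorusSite d m)).erase 0,
        Fc n a m2 (fun ν => (x ν).val) (fun ν => (x' ν).val) (latticeMomentum m k) := by
  rw [Rperp_eq_sum_Fc, card_tor_fine_cubic]
  have hsum : ∑ q ∈ (univ : Finset (Tor (cubic d m))).erase 0,
        Fc n a m2 (fun ν => (x ν).val) (fun ν => (x' ν).val) (sOf (cubic d m) q)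
      = ∑ k ∈ (univ : Finset (TorusSite d m)).erase 0,
        Fc n a m2 (fun ν => (x ν).val) (fun ν => (x' ν).val) (latticeMomentum m k) := by
    refine Finset.sum_congr rfl fun q _ => ?_
    obtain ⟨w, hw⟩ := sOf_cubic_congr (d := d) m q
    rw [hw, Fc_periodic]
  rw [hsum, Complex.real_smul, ← mul_assoc]
  congr 1
  have hn : (n : ℂ) ≠ 0 := by exact_mod_cast NeZero.ne n
  have hm : (m : ℂ) ≠ 0 := by exact_mod_cast NeZero.ne m
  push_cast
  rw [mul_pow, mul_inv, ← mul_assoc, mul_inv_cancel₀ (pow_ne_zero d hn), one_mul]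

/-- **THE INFINITE-VOLUME LIMIT OF THE WOODBURY KERNEL ALONG THE CUBIC TORI** (`d ≥ 3`, `n ≥ 1`, `a > 0`, `m² ≥ 0`;
even coarse periods `m → ∞`, fixed integer points `x, x′`):
`‖N^d R⊥_{N, (m,…,m)}(x, x′) − (2π)^{-d} ∫_{[-π,π]^d} F(θ; x, x′) dθ‖ ≤ ε` for all even `m ≥ m₀(ε, x, x′)`.
The limit kernel `R⊥_∞(x,x′) := N^{-d}(2π)^{-d}∫F` is therefore well defined and every volume-uniform window bound on
`R⊥` (`WoodburyFibre.norm_Rperp_le`, …) passes to it. This is the `T^{(j+1)} ↗ ℤ^d` step of B12 p. 264 for the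
Woodbury part of the one-step fluctuation propagator. [folklore] -/
theorem Rperp_tendsto_infiniteVolume (hd : 3 ≤ d) (hn : 1 ≤ n) {a m2 : ℝ} (ha : 0 < a) (hm2 : 0 ≤ m2)
    (x x' : Fin d → ℕ) {ε : ℝ} (hε : 0 < ε) :
    ∃ m₀ : ℕ, ∀ (m : ℕ) [NeZero m], Even m → m₀ ≤ m →
      ‖((n : ℂ) ^ d) * Rperp n (cubic d m) a m2 (fun ν => ((x ν : ℕ) : ZMod (fine n (cubic d m) ν)))
            (fun ν => ((x' ν : ℕ) : ZMod (fine n (cubic d m) ν)))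
          - (((2 * π) ^ d)⁻¹ : ℝ) • ∫ θ in brillouin d, Fc n a m2 x x' θ‖ ≤ ε := by
  have hd0 : 0 < d := by omega
  obtain ⟨L₁, hL₁⟩ := momentumAverage_singular_approx (E := ℂ) hd (C0_nonneg (d := d) hm2)
    (by positivity : (0 : ℝ) ≤ π ^ 2 / 4) (continuousOn_Fc_brillouin n ha hm2 x x')
    (fun θ hθ hθ0 => norm_Fc_le_of_mem_brillouin n hd0 hn ha hm2 x x' θ hθ hθ0) (Fc_periodic n a m2 x x') hε
  refine ⟨max L₁ (univ.sup x + univ.sup x' + 1), fun m _ hev hm => ?_⟩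
  have hm₁ : L₁ ≤ m := le_trans (le_max_left _ _) hm
  have hm₂ : univ.sup x + univ.sup x' + 1 ≤ m := le_trans (le_max_right _ _) hm
  have hnm : m ≤ n * m := Nat.le_mul_of_pos_left m (by omega)
  have hx : ∀ ν, x ν < n * m := fun ν => by
    have h1 : x ν ≤ univ.sup x := Finset.le_sup (mem_univ ν)
    omega
  have hx' : ∀ ν, x' ν < n * m := fun ν => by
    have h1 : x' ν ≤ univ.sup x' := Finset.le_sup (mem_univ ν)
    omega
  rw [Rperp_cubic_eq, val_natCast_fine n hx, val_natCast_fine n hx']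
  exact hL₁ m hev hm₁

open Literature.MathematicalPhysics.QuantumFieldTheory.Balaban1983to89.Beta.WoodburyFibre (woodburyD norm_Rperp_le)

/-- **THE FLAT WINDOW BOUND PASSES TO THE INFINITE-VOLUME KERNEL** (`d = 4`): the volume-uniform bound
`‖R⊥‖ ≤ D/N⁴` of `WoodburyFibre.norm_Rperp_le` gives `‖(2π)^{-4}∫_{[-π,π]^4} F(θ; x, x′) dθ‖ ≤ D(m²)` for the limit
symbol average (`= N^4 · R⊥_∞(x,x′)`). [folklore] -/
theorem norm_integral_Fc_le (hn : 1 ≤ n) {a m2 : ℝ} (ha : 0 < a) (hm2 : 0 ≤ m2) (x x' : Fin 4 → ℕ) :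
    ‖(((2 * π) ^ 4)⁻¹ : ℝ) • ∫ θ in brillouin 4, Fc n a m2 x x' θ‖ ≤ woodburyD m2 := by
  refine le_of_forall_pos_le_add fun ε hε => ?_
  obtain ⟨m₀, hm₀⟩ := Rperp_tendsto_infiniteVolume n (d := 4) (by norm_num) hn ha hm2 x x' hε
  set m : ℕ := 2 * (m₀ + 1) with hm_def
  haveI : NeZero m := ⟨by omega⟩
  have hev : Even m := ⟨m₀ + 1, by omega⟩
  have h := hm₀ m hev (by omega)
  set xm : Tor (fine n (cubic 4 m)) := fun ν => ((x ν : ℕ) : ZMod (fine n (cubic 4 m) ν)) with hxm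
  set xm' : Tor (fine n (cubic 4 m)) := fun ν => ((x' ν : ℕ) : ZMod (fine n (cubic 4 m) ν)) with hxm'
  set R : ℂ := ((n : ℂ) ^ 4) * Rperp n (cubic 4 m) a m2 xm xm' with hR
  set Lim : ℂ := (((2 * π) ^ 4)⁻¹ : ℝ) • ∫ θ in brillouin 4, Fc n a m2 x x' θ with hLim
  have hnR : (0 : ℝ) < n := by exact_mod_cast (show 0 < n by omega)
  have hRle : ‖R‖ ≤ woodburyD m2 := by
    have h1 : ‖Rperp n (cubic 4 m) a m2 xm xm'‖ ≤ woodburyD m2 / (n : ℝ) ^ 4 := norm_Rperp_le n m hn ha hm2 xm xm'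
    rw [hR, norm_mul]
    have h2 : ‖((n : ℂ) ^ 4)‖ = (n : ℝ) ^ 4 := by simp
    rw [h2]
    calc (n : ℝ) ^ 4 * ‖Rperp n (cubic 4 m) a m2 xm xm'‖ ≤ (n : ℝ) ^ 4 * (woodburyD m2 / (n : ℝ) ^ 4) := by
          gcongr
      _ = woodburyD m2 := by field_simp
  calc ‖Lim‖ = ‖R - (R - Lim)‖ := by rw [sub_sub_cancel]
    _ ≤ ‖R‖ + ‖R - Lim‖ := norm_sub_le _ _
    _ ≤ woodburyD m2 + ε := add_le_add hRle h

/-! ## §6 (v1.1, append-only) The limit kernel `R⊥_∞` on `ℕ^d × ℕ^d`, its lattice differences, and the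
transfer of EVERY volume-uniform bound of `WoodburyFibre` (§4 flat, §6 differenced, §9 Hermitian) to it

Pattern (two lines each, recorded once so the assembly can cite it): a bound `‖K_T‖ ≤ B` uniform in the torus `T`
and a convergence `K_T → K_∞` along the even cubic tori give `‖K_∞‖ ≤ B` (`norm_le_of_near` +
`le_of_forall_pos_le_add`). -/

open Literature.MathematicalPhysics.QuantumFieldTheory.Balaban1983to89.Beta.WoodburyFibre (dRperp ddRperp dRperp'
  woodburyD1 woodburyD2 norm_dRperp_le norm_ddRperp_le norm_dRperp'_le Rperp_swap)
open Literature.MathematicalPhysics.QuantumFieldTheory.Balaban1983to89.B5Prop11Plancherel (unitVec)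

/-- the EMBEDDING of an integer point `x ∈ ℕ^d` into the fine torus of periods `n·m`. [folklore] -/
def emb (m : ℕ) (x : Fin d → ℕ) : Tor (fine n (cubic d m)) := fun ν => ((x ν : ℕ) : ZMod (fine n (cubic d m) ν))

/-- `x + e_μ` on integer points. [folklore] -/
def bump (μ : Fin d) (x : Fin d → ℕ) : Fin d → ℕ := x + Pi.single μ 1

omit [NeZero n] in
/-- the embedding intertwines `x ↦ x + e_μ` with the torus shift by `unitVec`. [folklore] -/
theorem emb_bump (m : ℕ) (μ : Fin d) (x : Fin d → ℕ) :
    emb n m (bump μ x) = emb n m x + unitVec (fine n (cubic d m)) μ := by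
  funext ν
  by_cases h : ν = μ
  · subst h
    simp [emb, bump, unitVec, Pi.single_eq_same]
  · simp [emb, bump, unitVec, Pi.single_eq_of_ne h]

/-- **THE INFINITE-VOLUME WOODBURY KERNEL** `R⊥_∞(x, x′) := N^{-d}·(2π)^{-d}∫_{[-π,π]^d} F(θ; x, x′) dθ` on integer
points. [folklore] -/
noncomputable def RperpLim (a m2 : ℝ) (x x' : Fin d → ℕ) : ℂ :=
  ((n : ℂ) ^ d)⁻¹ * ((((2 * π) ^ d)⁻¹ : ℝ) • ∫ θ in brillouin d, Fc n a m2 x x' θ)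

/-- `∇_μ^x R⊥_∞` (literal difference). [folklore] -/
noncomputable def dRperpLim (a m2 : ℝ) (μ : Fin d) (x x' : Fin d → ℕ) : ℂ :=
  RperpLim n a m2 (bump μ x) x' - RperpLim n a m2 x x'

/-- `∇′_ν^{x′} R⊥_∞`. [folklore] -/
noncomputable def dRperpLim' (a m2 : ℝ) (ν : Fin d) (x x' : Fin d → ℕ) : ℂ :=
  RperpLim n a m2 x (bump ν x') - RperpLim n a m2 x x'

/-- `∇_μ^x ∇_ν^{x′} R⊥_∞`. [folklore] -/
noncomputable def ddRperpLim (a m2 : ℝ) (μ ν : Fin d) (x x' : Fin d → ℕ) : ℂ :=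
  RperpLim n a m2 (bump μ x) (bump ν x') - RperpLim n a m2 (bump μ x) x' - RperpLim n a m2 x (bump ν x')
    + RperpLim n a m2 x x'

omit [NeZero n] in
/-- the transfer pattern: `‖R‖ ≤ B`, `‖R − L‖ ≤ ε` ⇒ `‖L‖ ≤ B + ε`. [folklore] -/
theorem norm_le_of_near {L R : ℂ} {B ε : ℝ} (hR : ‖R‖ ≤ B) (h : ‖R - L‖ ≤ ε) : ‖L‖ ≤ B + ε :=
  calc ‖L‖ = ‖R - (R - L)‖ := by rw [sub_sub_cancel]
    _ ≤ ‖R‖ + ‖R - L‖ := norm_sub_le _ _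
    _ ≤ B + ε := add_le_add hR h

/-- **`R⊥ → R⊥_∞` ENTRYWISE ALONG THE EVEN CUBIC TORI** (`d ≥ 3`): for every `ε > 0` and all even `m ≥ m₀`,
`‖R⊥_{N,(m,…,m)}(x̂, x̂′) − R⊥_∞(x, x′)‖ ≤ ε`. [folklore] -/
theorem Rperp_tendsto_RperpLim (hd : 3 ≤ d) (hn : 1 ≤ n) {a m2 : ℝ} (ha : 0 < a) (hm2 : 0 ≤ m2)
    (x x' : Fin d → ℕ) {ε : ℝ} (hε : 0 < ε) :
    ∃ m₀ : ℕ, ∀ (m : ℕ) [NeZero m], Even m → m₀ ≤ m →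
      ‖Rperp n (cubic d m) a m2 (emb n m x) (emb n m x') - RperpLim n a m2 x x'‖ ≤ ε := by
  have hn0 : (n : ℂ) ≠ 0 := by exact_mod_cast NeZero.ne n
  have hnC : ((n : ℂ) ^ d) ≠ 0 := pow_ne_zero d hn0
  have hnR : (0 : ℝ) < (n : ℝ) := by exact_mod_cast (show 0 < n by omega)
  obtain ⟨m₀, hm₀⟩ := Rperp_tendsto_infiniteVolume n hd hn ha hm2 x x' (ε := ε * (n : ℝ) ^ d) (by positivity)
  refine ⟨m₀, fun m _ hev hm => ?_⟩
  have h := hm₀ m hev hm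
  have key : Rperp n (cubic d m) a m2 (emb n m x) (emb n m x') - RperpLim n a m2 x x'
      = ((n : ℂ) ^ d)⁻¹ * (((n : ℂ) ^ d) * Rperp n (cubic d m) a m2 (emb n m x) (emb n m x')
          - ((((2 * π) ^ d)⁻¹ : ℝ) • ∫ θ in brillouin d, Fc n a m2 x x' θ)) := by
    unfold RperpLim
    rw [mul_sub, ← mul_assoc, inv_mul_cancel₀ hnC, one_mul]
  rw [key, norm_mul, norm_inv, norm_pow, Complex.norm_natCast]
  calc ((n : ℝ) ^ d)⁻¹ * ‖((n : ℂ) ^ d) * Rperp n (cubic d m) a m2 (emb n m x) (emb n m x')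
          - ((((2 * π) ^ d)⁻¹ : ℝ) • ∫ θ in brillouin d, Fc n a m2 x x' θ)‖
      ≤ ((n : ℝ) ^ d)⁻¹ * (ε * (n : ℝ) ^ d) := by gcongr; exact h
    _ = ε := by field_simp

/-- the differenced kernels at embedded points are differences of `R⊥` at embedded bumped points. [folklore] -/
theorem dRperp_emb (m : ℕ) [NeZero m] (a m2 : ℝ) (μ : Fin d) (x x' : Fin d → ℕ) :
    dRperp n (cubic d m) a m2 μ (emb n m x) (emb n m x')
      = Rperp n (cubic d m) a m2 (emb n m (bump μ x)) (emb n m x') - Rperp n (cubic d m) a m2 (emb n m x) (emb n m x') := by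
  unfold dRperp; rw [emb_bump]

/-- see `dRperp_emb`. [folklore] -/
theorem dRperp'_emb (m : ℕ) [NeZero m] (a m2 : ℝ) (ν : Fin d) (x x' : Fin d → ℕ) :
    dRperp' n (cubic d m) a m2 ν (emb n m x) (emb n m x')
      = Rperp n (cubic d m) a m2 (emb n m x) (emb n m (bump ν x')) - Rperp n (cubic d m) a m2 (emb n m x) (emb n m x') := by
  unfold dRperp'; rw [emb_bump]

/-- see `dRperp_emb`. [folklore] -/
theorem ddRperp_emb (m : ℕ) [NeZero m] (a m2 : ℝ) (μ ν : Fin d) (x x' : Fin d → ℕ) :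
    ddRperp n (cubic d m) a m2 μ ν (emb n m x) (emb n m x')
      = Rperp n (cubic d m) a m2 (emb n m (bump μ x)) (emb n m (bump ν x'))
        - Rperp n (cubic d m) a m2 (emb n m (bump μ x)) (emb n m x')
        - Rperp n (cubic d m) a m2 (emb n m x) (emb n m (bump ν x')) + Rperp n (cubic d m) a m2 (emb n m x) (emb n m x') := by
  unfold ddRperp; rw [emb_bump, emb_bump]

/-- `∇R⊥ → ∇R⊥_∞` along the even cubic tori (`d ≥ 3`). [folklore] -/
theorem dRperp_tendsto (hd : 3 ≤ d) (hn : 1 ≤ n) {a m2 : ℝ} (ha : 0 < a) (hm2 : 0 ≤ m2) (μ : Fin d)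
    (x x' : Fin d → ℕ) {ε : ℝ} (hε : 0 < ε) :
    ∃ m₀ : ℕ, ∀ (m : ℕ) [NeZero m], Even m → m₀ ≤ m →
      ‖dRperp n (cubic d m) a m2 μ (emb n m x) (emb n m x') - dRperpLim n a m2 μ x x'‖ ≤ ε := by
  obtain ⟨m₁, h₁⟩ := Rperp_tendsto_RperpLim n hd hn ha hm2 (bump μ x) x' (half_pos hε)
  obtain ⟨m₂, h₂⟩ := Rperp_tendsto_RperpLim n hd hn ha hm2 x x' (half_pos hε)
  refine ⟨max m₁ m₂, fun m _ hev hm => ?_⟩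
  rw [dRperp_emb]
  unfold dRperpLim
  have e1 := h₁ m hev (le_of_max_le_left hm)
  have e2 := h₂ m hev (le_of_max_le_right hm)
  calc ‖Rperp n (cubic d m) a m2 (emb n m (bump μ x)) (emb n m x') - Rperp n (cubic d m) a m2 (emb n m x) (emb n m x')
          - (RperpLim n a m2 (bump μ x) x' - RperpLim n a m2 x x')‖
      = ‖(Rperp n (cubic d m) a m2 (emb n m (bump μ x)) (emb n m x') - RperpLim n a m2 (bump μ x) x')
          - (Rperp n (cubic d m) a m2 (emb n m x) (emb n m x') - RperpLim n a m2 x x')‖ := by ring_nf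
    _ ≤ _ := norm_sub_le _ _
    _ ≤ ε / 2 + ε / 2 := add_le_add e1 e2
    _ = ε := by ring

/-- `∇′R⊥ → ∇′R⊥_∞` along the even cubic tori (`d ≥ 3`). [folklore] -/
theorem dRperp'_tendsto (hd : 3 ≤ d) (hn : 1 ≤ n) {a m2 : ℝ} (ha : 0 < a) (hm2 : 0 ≤ m2) (ν : Fin d)
    (x x' : Fin d → ℕ) {ε : ℝ} (hε : 0 < ε) :
    ∃ m₀ : ℕ, ∀ (m : ℕ) [NeZero m], Even m → m₀ ≤ m →
      ‖dRperp' n (cubic d m) a m2 ν (emb n m x) (emb n m x') - dRperpLim' n a m2 ν x x'‖ ≤ ε := by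
  obtain ⟨m₁, h₁⟩ := Rperp_tendsto_RperpLim n hd hn ha hm2 x (bump ν x') (half_pos hε)
  obtain ⟨m₂, h₂⟩ := Rperp_tendsto_RperpLim n hd hn ha hm2 x x' (half_pos hε)
  refine ⟨max m₁ m₂, fun m _ hev hm => ?_⟩
  rw [dRperp'_emb]
  unfold dRperpLim'
  have e1 := h₁ m hev (le_of_max_le_left hm)
  have e2 := h₂ m hev (le_of_max_le_right hm)
  calc ‖Rperp n (cubic d m) a m2 (emb n m x) (emb n m (bump ν x')) - Rperp n (cubic d m) a m2 (emb n m x) (emb n m x')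
          - (RperpLim n a m2 x (bump ν x') - RperpLim n a m2 x x')‖
      = ‖(Rperp n (cubic d m) a m2 (emb n m x) (emb n m (bump ν x')) - RperpLim n a m2 x (bump ν x'))
          - (Rperp n (cubic d m) a m2 (emb n m x) (emb n m x') - RperpLim n a m2 x x')‖ := by ring_nf
    _ ≤ _ := norm_sub_le _ _
    _ ≤ ε / 2 + ε / 2 := add_le_add e1 e2
    _ = ε := by ring

/-- `∇∇′R⊥ → ∇∇′R⊥_∞` along the even cubic tori (`d ≥ 3`). [folklore] -/
theorem ddRperp_tendsto (hd : 3 ≤ d) (hn : 1 ≤ n) {a m2 : ℝ} (ha : 0 < a) (hm2 : 0 ≤ m2) (μ ν : Fin d)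
    (x x' : Fin d → ℕ) {ε : ℝ} (hε : 0 < ε) :
    ∃ m₀ : ℕ, ∀ (m : ℕ) [NeZero m], Even m → m₀ ≤ m →
      ‖ddRperp n (cubic d m) a m2 μ ν (emb n m x) (emb n m x') - ddRperpLim n a m2 μ ν x x'‖ ≤ ε := by
  have hε4 : 0 < ε / 4 := by positivity
  obtain ⟨m₁, h₁⟩ := Rperp_tendsto_RperpLim n hd hn ha hm2 (bump μ x) (bump ν x') hε4
  obtain ⟨m₂, h₂⟩ := Rperp_tendsto_RperpLim n hd hn ha hm2 (bump μ x) x' hε4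
  obtain ⟨m₃, h₃⟩ := Rperp_tendsto_RperpLim n hd hn ha hm2 x (bump ν x') hε4
  obtain ⟨m₄, h₄⟩ := Rperp_tendsto_RperpLim n hd hn ha hm2 x x' hε4
  refine ⟨max (max m₁ m₂) (max m₃ m₄), fun m _ hev hm => ?_⟩
  rw [ddRperp_emb]
  unfold ddRperpLim
  have hm12 := le_of_max_le_left hm
  have hm34 := le_of_max_le_right hm
  have e1 := h₁ m hev (le_of_max_le_left hm12)
  have e2 := h₂ m hev (le_of_max_le_right hm12)
  have e3 := h₃ m hev (le_of_max_le_left hm34)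
  have e4 := h₄ m hev (le_of_max_le_right hm34)
  set A := Rperp n (cubic d m) a m2 (emb n m (bump μ x)) (emb n m (bump ν x'))
  set B := Rperp n (cubic d m) a m2 (emb n m (bump μ x)) (emb n m x')
  set C := Rperp n (cubic d m) a m2 (emb n m x) (emb n m (bump ν x'))
  set D := Rperp n (cubic d m) a m2 (emb n m x) (emb n m x')
  set A' := RperpLim n a m2 (bump μ x) (bump ν x')
  set B' := RperpLim n a m2 (bump μ x) x'
  set C' := RperpLim n a m2 x (bump ν x')
  set D' := RperpLim n a m2 x x'
  calc ‖A - B - C + D - (A' - B' - C' + D')‖ = ‖((A - A') - (B - B')) - ((C - C') - (D - D'))‖ := by ring_nf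
    _ ≤ ‖(A - A') - (B - B')‖ + ‖(C - C') - (D - D')‖ := norm_sub_le _ _
    _ ≤ (‖A - A'‖ + ‖B - B'‖) + (‖C - C'‖ + ‖D - D'‖) := add_le_add (norm_sub_le _ _) (norm_sub_le _ _)
    _ ≤ (ε / 4 + ε / 4) + (ε / 4 + ε / 4) := by gcongr
    _ = ε := by ring

/-- **HERMITIAN SYMMETRY OF THE LIMIT KERNEL** (`d ≥ 3`): `R⊥_∞(x′, x) = conj R⊥_∞(x, x′)` — inherited from
`WoodburyFibre.Rperp_swap` through the limit. [folklore] -/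
theorem RperpLim_swap (hd : 3 ≤ d) (hn : 1 ≤ n) {a m2 : ℝ} (ha : 0 < a) (hm2 : 0 ≤ m2) (x x' : Fin d → ℕ) :
    RperpLim n a m2 x' x = conj (RperpLim n a m2 x x') := by
  refine eq_of_forall_dist_le fun ε hε => ?_
  obtain ⟨m₁, h₁⟩ := Rperp_tendsto_RperpLim n hd hn ha hm2 x' x (half_pos hε)
  obtain ⟨m₂, h₂⟩ := Rperp_tendsto_RperpLim n hd hn ha hm2 x x' (half_pos hε)
  set m : ℕ := 2 * (max m₁ m₂ + 1) with hm_def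
  haveI : NeZero m := ⟨by omega⟩
  have hev : Even m := ⟨max m₁ m₂ + 1, by omega⟩
  have e1 := h₁ m hev (by omega)
  have e2 := h₂ m hev (by omega)
  have hsw := Rperp_swap n (cubic d m) a m2 (emb n m x) (emb n m x')
  rw [dist_eq_norm]
  set R := Rperp n (cubic d m) a m2 (emb n m x) (emb n m x')
  set L := RperpLim n a m2 x x'
  set L' := RperpLim n a m2 x' x
  have key : L' - conj L = -(Rperp n (cubic d m) a m2 (emb n m x') (emb n m x) - L') + conj (R - L) := by
    rw [hsw, map_sub]; ring
  rw [key]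
  calc ‖-(Rperp n (cubic d m) a m2 (emb n m x') (emb n m x) - L') + conj (R - L)‖
      ≤ ‖-(Rperp n (cubic d m) a m2 (emb n m x') (emb n m x) - L')‖ + ‖conj (R - L)‖ := norm_add_le _ _
    _ = ‖Rperp n (cubic d m) a m2 (emb n m x') (emb n m x) - L'‖ + ‖R - L‖ := by rw [norm_neg, Complex.norm_conj]
    _ ≤ ε / 2 + ε / 2 := add_le_add e1 e2
    _ = ε := by ring

/-! ### `d = 4`: the volume-uniform bounds of `WoodburyFibre` pass to the limit kernel -/

omit [NeZero n] in
/-- an even period beyond any threshold. [folklore] -/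
theorem exists_even_ge (m₀ : ℕ) : ∃ m : ℕ, m ≠ 0 ∧ Even m ∧ m₀ ≤ m :=
  ⟨2 * (m₀ + 1), by omega, ⟨m₀ + 1, by omega⟩, by omega⟩

/-- **`‖R⊥_∞(x,x′)‖ ≤ D(m²)/N⁴`** (`d = 4`; from `WoodburyFibre.norm_Rperp_le`). [folklore] -/
theorem norm_RperpLim_le (hn : 1 ≤ n) {a m2 : ℝ} (ha : 0 < a) (hm2 : 0 ≤ m2) (x x' : Fin 4 → ℕ) :
    ‖RperpLim n a m2 x x'‖ ≤ woodburyD m2 / (n : ℝ) ^ 4 := by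
  refine le_of_forall_pos_le_add fun ε hε => ?_
  obtain ⟨m₀, hm₀⟩ := Rperp_tendsto_RperpLim n (d := 4) (by norm_num) hn ha hm2 x x' hε
  obtain ⟨m, hm0, hev, hm⟩ := exists_even_ge m₀
  haveI : NeZero m := ⟨hm0⟩
  exact norm_le_of_near (norm_Rperp_le n m hn ha hm2 (emb n m x) (emb n m x')) (hm₀ m hev hm)

/-- **`‖∇_μ R⊥_∞(x,x′)‖ ≤ D₁(m²)/N⁵`** (`d = 4`; from `WoodburyFibre.norm_dRperp_le`). [folklore] -/
theorem norm_dRperpLim_le (hn : 1 ≤ n) {a m2 : ℝ} (ha : 0 < a) (hm2 : 0 ≤ m2) (μ : Fin 4) (x x' : Fin 4 → ℕ) :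
    ‖dRperpLim n a m2 μ x x'‖ ≤ woodburyD1 m2 / (n : ℝ) ^ 5 := by
  refine le_of_forall_pos_le_add fun ε hε => ?_
  obtain ⟨m₀, hm₀⟩ := dRperp_tendsto n (d := 4) (by norm_num) hn ha hm2 μ x x' hε
  obtain ⟨m, hm0, hev, hm⟩ := exists_even_ge m₀
  haveI : NeZero m := ⟨hm0⟩
  exact norm_le_of_near (norm_dRperp_le n m hn ha hm2 μ (emb n m x) (emb n m x')) (hm₀ m hev hm)

/-- **`‖∇′_ν R⊥_∞(x,x′)‖ ≤ D₁(m²)/N⁵`** (`d = 4`; from `WoodburyFibre.norm_dRperp'_le`). [folklore] -/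
theorem norm_dRperpLim'_le (hn : 1 ≤ n) {a m2 : ℝ} (ha : 0 < a) (hm2 : 0 ≤ m2) (ν : Fin 4) (x x' : Fin 4 → ℕ) :
    ‖dRperpLim' n a m2 ν x x'‖ ≤ woodburyD1 m2 / (n : ℝ) ^ 5 := by
  refine le_of_forall_pos_le_add fun ε hε => ?_
  obtain ⟨m₀, hm₀⟩ := dRperp'_tendsto n (d := 4) (by norm_num) hn ha hm2 ν x x' hε
  obtain ⟨m, hm0, hev, hm⟩ := exists_even_ge m₀
  haveI : NeZero m := ⟨hm0⟩
  exact norm_le_of_near (norm_dRperp'_le n m hn ha hm2 ν (emb n m x) (emb n m x')) (hm₀ m hev hm)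

/-- **`‖∇_μ∇′_ν R⊥_∞(x,x′)‖ ≤ D₂(m²)/N⁶`** (`d = 4`; from `WoodburyFibre.norm_ddRperp_le`). [folklore] -/
theorem norm_ddRperpLim_le (hn : 1 ≤ n) {a m2 : ℝ} (ha : 0 < a) (hm2 : 0 ≤ m2) (μ ν : Fin 4)
    (x x' : Fin 4 → ℕ) :
    ‖ddRperpLim n a m2 μ ν x x'‖ ≤ woodburyD2 m2 / (n : ℝ) ^ 6 := by
  refine le_of_forall_pos_le_add fun ε hε => ?_
  obtain ⟨m₀, hm₀⟩ := ddRperp_tendsto n (d := 4) (by norm_num) hn ha hm2 μ ν x x' hε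
  obtain ⟨m, hm0, hev, hm⟩ := exists_even_ge m₀
  haveI : NeZero m := ⟨hm0⟩
  exact norm_le_of_near (norm_ddRperp_le n m hn ha hm2 μ ν (emb n m x) (emb n m x')) (hm₀ m hev hm)

end Literature.MathematicalPhysics.QuantumFieldTheory.Balaban1983to89.Beta.WoodburySymbol
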